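import Summits.BirchSwinnertonDyer.BirchSwinnertonDyer.Theorems.CyclotomicUntwistTwistedMomentAtLevel
import Literature.NumberTheory.EllipticCurves.RohrlichNonvanishingCoeffFieldProofs
import HarnessLib

/-!
# Rohrlich's first moment over a sparse Galois family of characters of conductor `p^m`, at a
# prime `p` DIVIDING the level (Atkin–Lehner flip at the prime-to-`p` part)

Cell `pub/bsd-wall` (D-0145 line `route-BirchSwinnertonDyer-CyclotomicUntwist`), seat `bsd-line-cycu-p5`
(width seat 5), helper toward crux K1 `PSRankOneLowerHalfAtThree` (stmt-BirchSwinnertonDyer-21580), D1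
currency. THEOREMS ONLY (no definition, no named fact, no `sorry`); BSD is not proved by this file and
no crux is. Route-free modular-form content (namespace `…Theorems.PSRohrlichAtLevel`).

The tree proves Rohrlich's theorem (Invent. Math. 75 (1984), Theorem p. 409: only finitely many
primitive `χ` of `p`-power conductor have `L(f, χ, 1) = 0`) for rational newforms at primes
`p ∤ N` (`RohrlichNonvanishingProofs.Rohrlich1984_primePow_of_coeffField_eq_bot`): Galois
conjugation of a vanishing value (`twistedSymbolSum_pow_eq_zero_of_coprime`), the sub-coset family
`χ⟨χ^{p(p-1)}⟩` with sparse character sum, and the first moment over such a family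
(`exists_forall_family_exists_twistedSymbolSum_ne_zero`) — whose two-sided series flips by the
FRICKE involution, whence `p ∤ N`. This file re-runs the family moment with the ATKIN–LEHNER flip at
the exact divisor `Q ∥ N`, `p ∤ Q`, `N ∣ Q p^m` (companion `CyclotomicUntwistTwistedMomentAtLevel`:
`twistedSymbolSum_inv_eq_dampedTwist_atkinLehner`), i.e. with `N ↦ Q` in the dual term:

* `sum_family_twistedSymbolSum_eq_atkinLehner` — for `w_Q f = w f` (`w² = 1`) and a family `X`
  of primitive characters mod `p^m` of constant parity `ε`:
  `∑_{χ ∈ X} (τ(χ)/p^m) ∑_a χ(a){∞,a/p^m}_f = ε (D_f(A, Y) − (w/p^m) D_f(B_Q, 1/(Q p^{2m} Y)))`,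
  `A = ∑_χ χ`, `B_Q(n) = ∑_χ χ(Q) τ(χ)² χ̄(n)`;
* `norm_dampedTwist_dual_le_of_support_of_not_dvd` — the dual error for a family with sparse
  character sum and weight `χ(Q)` (`norm_sum_mul_gaussSum_sq_le_of_support` + the generic
  `norm_dampedTwist_weight_le`);
* `exists_forall_family_exists_twistedSymbolSum_ne_zero_atkinLehner` — **no admissible family of
  large conductor `p^m` (`m ≥ m₀(f, p, Q)`) is killed by the symbol sums**, for `f` a
  `w_Q`-eigenform with `a₁ = 1`, `|aₙ| ≤ C n^θ`, `θ < 2/3`; verbatim the asymptotics of the tree's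
  theorem with `N ↦ Q` (exponent algebra `main_exponent_eq_offset`, `dual_exponent_eq_offset`,
  `pow_ceil_half_le_offset` of `RohrlichNonvanishingCoeffFieldProofs`).

Assembly (Rohrlich's theorem at ANY prime `p`): companion `CyclotomicUntwistRohrlichAtLevel`.
References: D. E. Rohrlich, Invent. Math. 75 (1984), 409–423, §§1–4 [cite: RohrlichInventiones1984, §3];
A. W. Knapp, *Elliptic curves* (1993), Lemma 9.24 [cite: Knapp1993, Lemma 9.24];
B. Mazur, J. Tate, J. Teitelbaum, Invent. Math. 84 (1986), §I.17 [cite: MazurTateTeitelbaum1986Invent, §I.17].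
-/

noncomputable section

open scoped MatrixGroups ModularForm BigOperators Real

open CongruenceSubgroup UpperHalfPlane Complex MeasureTheory Set Finset Filter Topology
  Literature.NumberTheory.EllipticCurves Literature.NumberTheory.EllipticCurves.ModularForms
  Summit.BirchSwinnertonDyer.BirchSwinnertonDyer.Theorems.PSTwistedMomentAtLevel

-- single-conjunct summit: `Summit.BirchSwinnertonDyer.BirchSwinnertonDyer.…` repeats the name by design
set_option linter.dupNamespace false
set_option autoImplicit false

namespace Summit.BirchSwinnertonDyer.BirchSwinnertonDyer.Theorems.PSRohrlichAtLevel

/-! ### The first-moment identity over a family, Atkin–Lehner form -/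

section Moment

variable {N : ℕ} [NeZero N] (f : CuspForm (Gamma0 N) 2) {p : ℕ} [hp : Fact p.Prime]
  {Q : ℕ} [NeZero Q]

/-- **The first-moment identity over a family at a prime dividing the level.** Let
`f ∈ S_2(Γ₀(N))` with `w_Q f = w f` for an exact divisor `Q ∥ N` with `p ∤ Q` and `N ∣ Q p^m`
(`w² = 1`), `Y > 0`, `Y' = 1/(Q p^{2m} Y)`, and let `X` be a finite family of *primitive* characters
mod `p^m` of constant parity `χ(-1) = ε`. Summing `twistedSymbolSum_inv_eq_dampedTwist_atkinLehner`
against the weights `τ(χ)/p^m` (`τ(χ)τ(χ̄) = χ(-1) p^m`):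
`∑_{χ ∈ X} (τ(χ)/p^m) ∑_a χ(a){∞, a/p^m}_f = ε · (D_f(A, Y) - (w/p^m) D_f(B_Q, Y'))`,
`A(n) = ∑_χ χ(n)`, `B_Q(n) = ∑_χ χ(Q) τ(χ)² χ̄(n)`. The Fricke case (`p ∤ N`, `Q = N`, pair
`(f, w_N f)`) is `sum_family_twistedSymbolSum_eq` (Rohrlich 1984, §2–3).
[cite: RohrlichInventiones1984, §3] -/
theorem sum_family_twistedSymbolSum_eq_atkinLehner (hQN : Q ∣ N) (hc : Nat.Coprime Q (N / Q))
    {w : ℂ} (hw : atkinLehnerInvolution N 2 Q f = w • f) (hw1 : w ^ 2 = 1) (hpQ : ¬ p ∣ Q)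
    {m : ℕ} [NeZero (p ^ m)] (hNm : N ∣ Q * p ^ m)
    (X : Finset (DirichletCharacter ℂ (p ^ m))) {ε : ℂ}
    (hX : ∀ χ ∈ X, χ.IsPrimitive ∧ χ (-1) = ε) {Y : ℝ} (hY : 0 < Y) :
    ∑ χ ∈ X, gaussSum χ (ZMod.stdAddChar (N := p ^ m)) / (p ^ m : ℂ) *
        twistedSymbolSum f χ⁻¹ =
      ε * (dampedTwist f (fun n ↦ ∑ χ ∈ X, χ n) Y -
        w / (p ^ m : ℂ) * dampedTwist f (fun n ↦ ∑ χ ∈ X,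
          χ Q * gaussSum χ (ZMod.stdAddChar (N := p ^ m)) ^ 2 * χ⁻¹ n)
            (1 / ((Q : ℝ) * (p ^ m : ℕ) ^ 2 * Y))) := by
  have hp' : p.Prime := Fact.out
  have hmQ : (p ^ m).Coprime Q := Nat.Coprime.pow_left _ ((Nat.Prime.coprime_iff_not_dvd hp').mpr hpQ)
  have hY' : 0 < 1 / ((Q : ℝ) * (p ^ m : ℕ) ^ 2 * Y) := by
    have : (0 : ℝ) < Q := Nat.cast_pos.mpr (NeZero.pos Q)
    have : (0 : ℝ) < (p ^ m : ℕ) := Nat.cast_pos.mpr (NeZero.pos _)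
    positivity
  have hpm : ((p ^ m : ℕ) : ℂ) ≠ 0 := Nat.cast_ne_zero.mpr (NeZero.ne _)
  -- termwise
  have hterm : ∀ χ ∈ X,
      gaussSum χ (ZMod.stdAddChar (N := p ^ m)) / (p ^ m : ℂ) * twistedSymbolSum f χ⁻¹ =
        ε * ((1 : ℂ) * dampedTwist f (fun n ↦ χ n) Y) -
          ε * (w / (p ^ m : ℂ) * ((χ Q * gaussSum χ (ZMod.stdAddChar (N := p ^ m)) ^ 2) *
            dampedTwist f (fun n ↦ χ⁻¹ n) (1 / ((Q : ℝ) * (p ^ m : ℕ) ^ 2 * Y)))) := by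
    intro χ hχ
    obtain ⟨hprim, hpar⟩ := hX χ hχ
    have h := twistedSymbolSum_inv_eq_dampedTwist_atkinLehner f hQN hc hw hw1 hmQ hNm hprim hY
    have hgg := Literature.NumberTheory.Sieve.LargeSieve.gaussSum_mul_gaussSum_inv hprim
    have h1 : χ⁻¹ (-1) = ε := by
      rw [MulChar.inv_apply_eq_inv', hpar]
      rcases apply_neg_one_eq_one_or χ with h' | h'
      · rw [← hpar, h', inv_one]
      · rw [← hpar, h', inv_neg, inv_one]
    rw [hpar] at hgg
    push_cast at h hgg ⊢
    rw [h, h1]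
    have hpm' : (p : ℂ) ^ m ≠ 0 := by exact_mod_cast hpm
    field_simp
    linear_combination dampedTwist f (fun n ↦ χ n) Y * hgg
  rw [Finset.sum_congr rfl hterm, Finset.sum_sub_distrib]
  have hA : ∑ χ ∈ X, ε * ((1 : ℂ) * dampedTwist f (fun n ↦ χ n) Y) =
      ε * dampedTwist f (fun n ↦ ∑ χ ∈ X, χ n) Y := by
    rw [← Finset.mul_sum, sum_mul_dampedTwist f X (fun _ ↦ (1 : ℂ))
      (fun (χ : DirichletCharacter ℂ (p ^ m)) (n : ℕ) ↦ χ n) (B := 1)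
      (fun χ n ↦ DirichletCharacter.norm_le_one χ _) hY]
    simp
  have hB : ∑ χ ∈ X, ε * (w / (p ^ m : ℂ) * ((χ Q * gaussSum χ (ZMod.stdAddChar (N := p ^ m)) ^ 2) *
      dampedTwist f (fun n ↦ χ⁻¹ n) (1 / ((Q : ℝ) * (p ^ m : ℕ) ^ 2 * Y)))) =
      ε * (w / (p ^ m : ℂ) * dampedTwist f (fun n ↦ ∑ χ ∈ X,
          χ Q * gaussSum χ (ZMod.stdAddChar (N := p ^ m)) ^ 2 * χ⁻¹ n)
            (1 / ((Q : ℝ) * (p ^ m : ℕ) ^ 2 * Y))) := by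
    rw [← Finset.mul_sum, ← Finset.mul_sum, sum_mul_dampedTwist f X _
      (fun (χ : DirichletCharacter ℂ (p ^ m)) (n : ℕ) ↦ χ⁻¹ n) (B := 1)
      (fun χ n ↦ DirichletCharacter.norm_le_one χ⁻¹ _) hY']
  rw [hA, hB, mul_sub]

end Moment

/-! ### The dual-term error for a sparse family with weight `χ(Q)` -/

section Errors

variable {N : ℕ} (g : CuspForm (Gamma0 N) 2) {p : ℕ} [hp : Fact p.Prime]

/-- **The dual-term error for a sparse family, weight `χ(Q)`.** For a cusp form `g ∈ S_2(Γ₀(N))`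
with `|bₙ| ≤ C n^θ` (`0 < θ ≤ 1`), `p ∤ Q`, `m ≥ 1`, `Y' > 0`, and a family `X` of characters mod
`p^m` with character sum supported in `{z : z^{2(p-1)} ≡ 1 (mod p^{m-1})}`:
`‖D_g(B_Q, Y')‖ ≤ #X · C · (4p² · 4p^{⌈m/2⌉}) · (1 + Γ(θ)(2πY')^{-θ})`,
`B_Q(n) = ∑_{χ ∈ X} χ(Q) τ(χ)² χ̄(n)` (the weight bound is `norm_sum_mul_gaussSum_sq_le_of_support`
at the unit `Q n⁻¹`; the case `Q = N` is `norm_dampedTwist_dual_le_of_support`).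
[cite: RohrlichInventiones1984, §4] -/
theorem norm_dampedTwist_dual_le_of_support_of_not_dvd {Q : ℕ} {m : ℕ} [NeZero (p ^ m)]
    (hm : m ≠ 0) (hpQ : ¬ p ∣ Q) (X : Finset (DirichletCharacter ℂ (p ^ m)))
    (hsupp : ∀ z : ZMod (p ^ m), ∑ χ ∈ X, χ z ≠ 0 →
      (ZMod.castHom (pow_dvd_pow p (Nat.sub_le m 1)) (ZMod (p ^ (m - 1))) z) ^ (2 * (p - 1)) = 1)
    {C θ : ℝ} (hC : 0 ≤ C) (hθ : 0 < θ) (hθ1 : θ ≤ 1)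
    (hb : ∀ n : ℕ, ‖cuspCoeff g n‖ ≤ C * (n : ℝ) ^ θ) {Y' : ℝ} (hY' : 0 < Y') :
    ‖dampedTwist g (fun n ↦ ∑ χ ∈ X,
        χ Q * gaussSum χ (ZMod.stdAddChar (N := p ^ m)) ^ 2 * χ⁻¹ n) Y'‖ ≤
      X.card * (C * (((4 * p * p : ℕ) * (4 * (p : ℝ) ^ (m - m / 2))) *
        (1 + Real.Gamma θ * (2 * Real.pi * Y') ^ (-θ)))) := by
  classical
  set β : ℝ := (4 * p * p : ℕ) * (4 * (p : ℝ) ^ (m - m / 2)) with hβ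
  have hβ0 : 0 ≤ β := by positivity
  set Bw : ℕ → ℂ := fun n ↦ ∑ χ ∈ X, χ Q * gaussSum χ (ZMod.stdAddChar (N := p ^ m)) ^ 2 * χ⁻¹ n
    with hBw
  have hQu : IsUnit ((Q : ℕ) : ZMod (p ^ m)) := by
    rw [ZMod.isUnit_iff_coprime]
    exact ((Nat.Prime.coprime_iff_not_dvd hp.out).mpr hpQ).symm.pow_right m
  -- bound for the weight
  have hBle : ∀ n : ℕ, ‖Bw n‖ ≤ X.card * β := by
    intro n
    by_cases hn : IsUnit ((n : ℕ) : ZMod (p ^ m))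
    · have : Bw n = ∑ χ ∈ X, χ ((Q : ZMod (p ^ m)) * ((n : ℕ) : ZMod (p ^ m))⁻¹) *
          gaussSum χ (ZMod.stdAddChar (N := p ^ m)) ^ 2 := by
        refine Finset.sum_congr rfl fun χ _ ↦ ?_
        rw [← mul_inv_apply_eq χ _ hn]; ring
      rw [this]
      have hyu : IsUnit ((Q : ZMod (p ^ m)) * ((n : ℕ) : ZMod (p ^ m))⁻¹) := by
        refine hQu.mul ?_
        rw [← hn.unit_spec, ZMod.inv_coe_unit]; exact Units.isUnit _
      have h := norm_sum_mul_gaussSum_sq_le_of_support hm X hsupp hyu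
      rw [hβ]
      refine h.trans (le_of_eq ?_)
      push_cast; ring
    · have : Bw n = 0 := Finset.sum_eq_zero fun χ _ ↦ by rw [MulChar.map_nonunit χ⁻¹ hn, mul_zero]
      rw [this, norm_zero]; positivity
  have h := norm_dampedTwist_weight_le g hC hθ hθ1 hb (by positivity : 0 ≤ (X.card : ℝ) * β)
    hBle hY'
  rw [hBw] at h
  refine h.trans (le_of_eq ?_)
  rw [hβ]; ring

end Errors

/-! ### Asymptotics: no admissible family of large conductor has all its symbol sums zero -/

section Final

variable {N : ℕ} [NeZero N] (f : CuspForm (Gamma0 N) 2) {p : ℕ} [hp : Fact p.Prime]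
  {Q : ℕ} [NeZero Q]

/-- **No admissible family of large conductor is killed by the symbol sums — at a prime dividing
the level.** Let `f ∈ S_2(Γ₀(N))` with `w_Q f = w f` for an exact divisor `Q ∥ N` with `p ∤ Q`
and `N ∣ Q p^{m₁}` (`w² = 1`), `a₁(f) = 1`, `|aₙ(f)| ≤ C n^θ` for some `θ < 2/3`. Then there is
`m₀` such that for every `m ≥ m₀` and every non-empty family `X` of primitive characters mod `p^m`
of constant parity whose character sum is supported in `{z : z^{2(p-1)} ≡ 1 (mod p^{m-1})}`, some
`χ ∈ X` has `∑_a χ̄(a){∞, a/p^m}_f ≠ 0`. Proof: the asymptotic argument of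
`exists_forall_family_exists_twistedSymbolSum_ne_zero` (Rohrlich 1984 §§2–4: `Y = p^{-am}`,
`3/2 < a < 1/θ`, moment `= ε #X (e^{-2πY} + O(δ_m))`, `δ_m → 0` uniformly in `X`) run on
`sum_family_twistedSymbolSum_eq_atkinLehner` with the errors `norm_dampedTwist_sum_sub_le_of_support`
(main, level-free) and `norm_dampedTwist_dual_le_of_support_of_not_dvd` (dual, weight `χ(Q)`).
[cite: RohrlichInventiones1984, §3] -/
theorem exists_forall_family_exists_twistedSymbolSum_ne_zero_atkinLehner (hQN : Q ∣ N)
    (hc : Nat.Coprime Q (N / Q)) {w : ℂ} (hw : atkinLehnerInvolution N 2 Q f = w • f)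
    (hw1 : w ^ 2 = 1) (hpQ : ¬ p ∣ Q) {m₁ : ℕ} (hNm₁ : N ∣ Q * p ^ m₁)
    {C θ : ℝ} (hC : 0 ≤ C) (hθ : 0 < θ) (hθ1 : θ < 2 / 3)
    (ha : ∀ n : ℕ, ‖cuspCoeff f n‖ ≤ C * (n : ℝ) ^ θ) (h1 : cuspCoeff f 1 = 1) :
    ∃ m₀ : ℕ, ∀ m : ℕ, m₀ ≤ m → ∀ (X : Finset (DirichletCharacter ℂ (p ^ m))) (ε : ℂ),
      X.Nonempty → (∀ χ ∈ X, χ.IsPrimitive ∧ χ (-1) = ε) →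
      (∀ z : ZMod (p ^ m), ∑ χ ∈ X, χ z ≠ 0 →
        (ZMod.castHom (pow_dvd_pow p (Nat.sub_le m 1)) (ZMod (p ^ (m - 1))) z) ^ (2 * (p - 1)) = 1) →
      ∃ χ ∈ X, twistedSymbolSum f χ⁻¹ ≠ 0 := by
  have hpr : (1 : ℝ) < p := by exact_mod_cast hp.out.one_lt
  have hp0 : (0 : ℝ) < p := by linarith
  have hQr : (0 : ℝ) < Q := Nat.cast_pos.mpr (NeZero.pos Q)
  have h2π : (0 : ℝ) < 2 * Real.pi := Real.two_pi_pos
  have hwn : ‖w‖ = 1 := by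
    have h : ‖w‖ ^ 2 = 1 := by rw [← norm_pow, hw1, norm_one]
    exact (pow_eq_one_iff_of_nonneg (norm_nonneg w) two_ne_zero).mp h
  have hθ'1 : θ ≤ 1 := by linarith
  -- the exponent `a`, `3/2 < a < 1/θ`
  set a : ℝ := 3 / 4 + 1 / (2 * θ) with hadef
  have haθ' : a * θ = 3 / 4 * θ + 1 / 2 := by
    rw [hadef]; field_simp
  have haθ : a * θ - 1 < 0 := by rw [haθ']; linarith
  have ha32 : 3 / 2 < a := by
    have : 3 / 4 < 1 / (2 * θ) := by
      rw [lt_div_iff₀ (by positivity)]; linarith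
    rw [hadef]; linarith
  have ha0 : 0 < a := by linarith
  have hdual : (2 - a) * θ - 1 / 2 < 0 := by nlinarith [mul_pos (sub_pos.mpr ha32) hθ, hθ'1]
  set X : ℕ → ℝ := fun m ↦ (p : ℝ) ^ m with hXdef
  set q : ℕ → ℝ := fun m ↦ (p : ℝ) ^ (m - 1) with hqdef
  set Y : ℕ → ℝ := fun m ↦ X m ^ (-a) with hYdef
  have hXpos : ∀ m, 0 < X m := fun m ↦ pow_pos hp0 m
  have hqpos : ∀ m, 0 < q m := fun m ↦ pow_pos hp0 _
  have hYpos : ∀ m, 0 < Y m := fun m ↦ Real.rpow_pos_of_pos (hXpos m) _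
  have hXq : ∀ m, m ≠ 0 → X m = p * q m := fun m hm ↦ by
    simp only [hXdef, hqdef]
    rw [← pow_succ', Nat.sub_add_cancel (Nat.pos_of_ne_zero hm)]
  set e₁ : ℝ := (θ - 1) / (2 * (p - 1) : ℝ) with he₁
  set K₃ : ℝ := Real.Gamma θ * ((2 * Real.pi) ^ (-θ) * (p : ℝ) ^ (a * θ)) with hK₃
  set err₁ : ℕ → ℝ := fun m ↦ C * ((4 * p : ℕ) *
    (q m ^ e₁ + (q m ^ (θ - 1) + K₃ * q m ^ (a * θ - 1)))) with herr₁
  set K₄ : ℝ := C * ((4 * p * p : ℕ) * (4 * (p : ℝ))) with hK₄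
  set K₅ : ℝ := Real.Gamma θ * (2 * Real.pi / Q) ^ (-θ) with hK₅
  set err₂ : ℕ → ℝ := fun m ↦ K₄ * (X m ^ (-(1 / 2 : ℝ)) + K₅ * X m ^ ((2 - a) * θ - 1 / 2))
    with herr₂
  have hXlim : Tendsto X atTop atTop := tendsto_pow_atTop_atTop_of_one_lt hpr
  have hqlim : Tendsto q atTop atTop :=
    (tendsto_pow_atTop_atTop_of_one_lt hpr).comp (tendsto_sub_atTop_nat 1)
  have hrpow : ∀ {Z : ℕ → ℝ} (_ : Tendsto Z atTop atTop) {e : ℝ} (_ : e < 0),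
      Tendsto (fun m ↦ Z m ^ e) atTop (𝓝 0) := by
    intro Z hZ e he
    have h := (tendsto_rpow_neg_atTop (neg_pos.mpr he)).comp hZ
    simp only [neg_neg] at h
    exact h
  have hp1r : (1 : ℝ) ≤ (p : ℝ) - 1 := by
    have : (2 : ℝ) ≤ p := by exact_mod_cast hp.out.two_le
    linarith
  have he₁neg : e₁ < 0 := div_neg_of_neg_of_pos (by linarith) (by positivity)
  have herr₁lim : Tendsto err₁ atTop (𝓝 0) := by
    have h := ((hrpow hqlim he₁neg).add ((hrpow hqlim (by linarith : θ - 1 < 0)).add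
      ((hrpow hqlim haθ).const_mul K₃))).const_mul ((4 * p : ℕ) : ℝ)
      |>.const_mul C
    simpa [herr₁] using h
  have herr₂lim : Tendsto err₂ atTop (𝓝 0) := by
    have h := ((hrpow hXlim (by norm_num : -(1 / 2 : ℝ) < 0)).add
      ((hrpow hXlim hdual).const_mul K₅)).const_mul K₄
    simpa [herr₂] using h
  have hexplim : Tendsto (fun m ↦ Real.exp (-(2 * Real.pi) * Y m)) atTop (𝓝 1) := by
    have hY0 : Tendsto Y atTop (𝓝 0) := hrpow hXlim (by linarith : -a < 0)
    have h0 : Tendsto (fun m ↦ -(2 * Real.pi) * Y m) atTop (𝓝 0) := by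
      simpa using hY0.const_mul (-(2 * Real.pi))
    have := (Real.continuous_exp.tendsto 0).comp h0
    rw [Real.exp_zero] at this
    refine this.congr fun m ↦ ?_
    simp only [Function.comp_apply]
  have hev : ∀ᶠ m in atTop, err₁ m + err₂ m < 1 / 2 ∧ 1 / 2 < Real.exp (-(2 * Real.pi) * Y m) ∧
      1 ≤ m ∧ m₁ ≤ m := by
    refine ((herr₁lim.add herr₂lim).eventually (gt_mem_nhds ?_)).and
      ((hexplim.eventually (lt_mem_nhds ?_)).and ((eventually_ge_atTop 1).and
        (eventually_ge_atTop m₁)))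
    · norm_num
    · norm_num
  obtain ⟨m₀, hm₀⟩ := eventually_atTop.mp hev
  refine ⟨m₀, fun m hm Xf ε hne hXf hsupp ↦ ?_⟩
  obtain ⟨hlt, hexp, hm1, hmm₁⟩ := hm₀ m hm
  by_contra hall
  push Not at hall
  have hm0 : m ≠ 0 := by omega
  have hNm : N ∣ Q * p ^ m := hNm₁.trans (mul_dvd_mul_left Q (pow_dvd_pow p hmm₁))
  have hcard : 0 < (Xf.card : ℝ) := by exact_mod_cast Finset.card_pos.mpr hne
  -- `ε ≠ 0`
  have hε : ε ≠ 0 := by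
    obtain ⟨χ, hχ⟩ := hne
    rw [← (hXf χ hχ).2]
    rcases apply_neg_one_eq_one_or χ with h | h
    · rw [h]; exact one_ne_zero
    · rw [h]; exact neg_ne_zero.mpr one_ne_zero
  have hmom : ∑ χ ∈ Xf, gaussSum χ (ZMod.stdAddChar (N := p ^ m)) / (p ^ m : ℂ) *
      twistedSymbolSum f χ⁻¹ = 0 :=
    Finset.sum_eq_zero fun χ hχ ↦ by rw [hall χ hχ, mul_zero]
  rw [sum_family_twistedSymbolSum_eq_atkinLehner f hQN hc hw hw1 hpQ hNm Xf hXf (hYpos m)] at hmom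
  replace hmom := (mul_eq_zero.mp hmom).resolve_left hε
  have hE₁ := norm_dampedTwist_sum_sub_le_of_support f (p := p) Xf hsupp hC hθ hθ'1 ha h1 (hYpos m)
  have hY'pos : 0 < 1 / ((Q : ℝ) * (p ^ m : ℕ) ^ 2 * Y m) := by
    have : (0 : ℝ) < (p ^ m : ℕ) := Nat.cast_pos.mpr (pow_pos hp.out.pos _)
    have := hYpos m
    positivity
  have hE₂ := norm_dampedTwist_dual_le_of_support_of_not_dvd f (p := p) (Q := Q) hm0 hpQ Xf hsupp
    hC hθ hθ'1 ha hY'pos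
  have hqM : ((p ^ (m - 1) : ℕ) : ℝ) = q m := by simp [hqdef]
  have hXM : ((p ^ m : ℕ) : ℝ) = X m := by simp [hXdef]
  have hA : (q m ^ (1 / (2 * (p - 1) : ℝ))) ^ (θ - 1) = q m ^ e₁ := by
    rw [← Real.rpow_mul (hqpos m).le, he₁]
    congr 1
    have : (2 * (p - 1) : ℝ) ≠ 0 := by positivity
    field_simp
  have hB : q m ^ (θ - 1) * (1 + Real.Gamma θ * (2 * Real.pi * Y m * q m) ^ (-θ)) =
      q m ^ (θ - 1) + K₃ * q m ^ (a * θ - 1) := by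
    rw [hYdef]
    dsimp only
    rw [hXq m hm0, hK₃]
    have h := main_exponent_eq_offset (θ := θ) (a := a) hp0 (hqpos m)
    linear_combination Real.Gamma θ * h
  have hE₁' : ‖dampedTwist f (fun n ↦ ∑ χ ∈ Xf, χ n) (Y m) -
      Xf.card * (Real.exp (-(2 * Real.pi) * Y m) : ℝ)‖ ≤ Xf.card * err₁ m := by
    have h := hE₁
    rw [hqM, hA, hB] at h
    simpa only [herr₁] using h
  have hE₂' : ‖(w / (p ^ m : ℂ)) * dampedTwist f (fun n ↦ ∑ χ ∈ Xf,
      χ Q * gaussSum χ (ZMod.stdAddChar (N := p ^ m)) ^ 2 * χ⁻¹ n) (1 / ((Q : ℝ) * (p ^ m : ℕ) ^ 2 * Y m))‖ ≤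
      Xf.card * err₂ m := by
    rw [norm_mul, norm_div, hwn, show ‖(p ^ m : ℂ)‖ = X m by
      rw [show (p ^ m : ℂ) = ((p ^ m : ℕ) : ℂ) by push_cast; rfl, Complex.norm_natCast, hXM]]
    refine (mul_le_mul_of_nonneg_left hE₂ (by positivity)).trans ?_
    rw [hXM]
    have hZ : (2 * Real.pi * (1 / ((Q : ℝ) * X m ^ 2 * Y m))) ^ (-θ) =
        (2 * Real.pi / Q) ^ (-θ) * X m ^ ((2 - a) * θ) := by
      rw [hYdef]; exact dual_exponent_eq_offset hQr (hXpos m)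
    have hpk : (p : ℝ) ^ (m - m / 2) ≤ p * X m ^ (1 / 2 : ℝ) := pow_ceil_half_le_offset hpr.le m
    have hG : 0 ≤ Real.Gamma θ := (Real.Gamma_pos_of_pos hθ).le
    have hx1 : X m ^ (1 / 2 : ℝ) / X m = X m ^ (-(1 / 2 : ℝ)) := by
      rw [div_eq_iff (hXpos m).ne', ← Real.rpow_add_one (hXpos m).ne']
      norm_num
    have hx2 : X m ^ (1 / 2 : ℝ) * X m ^ ((2 - a) * θ) / X m = X m ^ ((2 - a) * θ - 1 / 2) := by
      rw [div_eq_iff (hXpos m).ne', ← Real.rpow_add (hXpos m), ← Real.rpow_add_one (hXpos m).ne']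
      congr 1; ring
    rw [hZ]
    calc 1 / X m * ((Xf.card) * (C * (((4 * p * p : ℕ) * (4 * (p : ℝ) ^ (m - m / 2))) *
          (1 + Real.Gamma θ * ((2 * Real.pi / Q) ^ (-θ) * X m ^ ((2 - a) * θ))))))
        ≤ 1 / X m * ((Xf.card) * (C * (((4 * p * p : ℕ) * (4 * ((p : ℝ) * X m ^ (1 / 2 : ℝ)))) *
          (1 + Real.Gamma θ * ((2 * Real.pi / Q) ^ (-θ) * X m ^ ((2 - a) * θ)))))) := by
          gcongr
      _ = (Xf.card) * (C * ((4 * p * p : ℕ) * (4 * (p : ℝ)))) *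
          (X m ^ (1 / 2 : ℝ) / X m + Real.Gamma θ * (2 * Real.pi / Q) ^ (-θ) *
            (X m ^ (1 / 2 : ℝ) * X m ^ ((2 - a) * θ) / X m)) := by
          ring
      _ = (Xf.card) * err₂ m := by
          rw [hx1, hx2]
          simp only [herr₂, hK₄, hK₅]
          ring
  have hkey : (Xf.card : ℝ) * Real.exp (-(2 * Real.pi) * Y m) ≤
      Xf.card * err₁ m + Xf.card * err₂ m := by
    have hnorm : ‖((Xf.card) * (Real.exp (-(2 * Real.pi) * Y m) : ℝ) : ℂ)‖ =
        (Xf.card : ℝ) * Real.exp (-(2 * Real.pi) * Y m) := by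
      rw [show ((Xf.card) * (Real.exp (-(2 * Real.pi) * Y m) : ℝ) : ℂ) =
        (((Xf.card) * Real.exp (-(2 * Real.pi) * Y m) : ℝ) : ℂ) by push_cast; ring,
        Complex.norm_real, Real.norm_of_nonneg (by positivity)]
    rw [← hnorm]
    set D₁ := dampedTwist f (fun n ↦ ∑ χ ∈ Xf, χ n) (Y m)
    set D₂ := (w / (p ^ m : ℂ)) * dampedTwist f (fun n ↦ ∑ χ ∈ Xf,
      χ Q * gaussSum χ (ZMod.stdAddChar (N := p ^ m)) ^ 2 * χ⁻¹ n) (1 / ((Q : ℝ) * (p ^ m : ℕ) ^ 2 * Y m))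
    have hD : D₁ = D₂ := sub_eq_zero.mp hmom
    calc ‖((Xf.card) * (Real.exp (-(2 * Real.pi) * Y m) : ℝ) : ℂ)‖
        = ‖((((Xf.card) * (Real.exp (-(2 * Real.pi) * Y m) : ℝ) : ℂ) - D₁) + D₂)‖ := by
          rw [hD, sub_add_cancel]
      _ ≤ ‖((Xf.card) * (Real.exp (-(2 * Real.pi) * Y m) : ℝ) : ℂ) - D₁‖ + ‖D₂‖ :=
          norm_add_le _ _
      _ ≤ _ := by
          refine add_le_add ?_ hE₂'
          rw [norm_sub_rev]; exact hE₁'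
  have : Real.exp (-(2 * Real.pi) * Y m) ≤ err₁ m + err₂ m := by
    have h := hkey
    rw [← mul_add] at h
    exact le_of_mul_le_mul_left h hcard
  linarith

end Final

end Summit.BirchSwinnertonDyer.BirchSwinnertonDyer.Theorems.PSRohrlichAtLevel

end
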